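import Mathlib
import Summits.ValiantsHypothesis.ValiantsHypothesis.Theorems.FeketeSOSFeketeNoSparseSplitCharPFewnomial

/-!
# Crux `FeketeSOS.SublinearShadow` (stmt-ValiantsHypothesis-14990), line `Sketch`,
# stub `stub_charPFewnomialAnyDegree`: the char-`p` fewnomial lever at arbitrary degree

Over a field `K` of characteristic `p`, a non-zero polynomial `g` of ANY degree satisfies
`ord_{X=1}(g) mod p + 1 ≤ |supp g|`: the residue modulo `p` of the multiplicity `μ` of the root `1`
is less than the number of monomials.  (The sibling `cpf_main` is the case `deg g < p`; for
`deg g ≥ p` that form is false, `X^p - 1 = (X - 1)^p`.)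

Proof: strong induction on `|supp g|` with the Euler operator `h = X·g' - e·g`, `e = deg g`.
If `p ∣ μ` the claim is `1 ≤ |supp g|`.  Otherwise `μ = m + 1` with `(m + 1 : K) ≠ 0`; writing
`g = (X - 1)^(m+1) u` with `u(1) ≠ 0` one gets `h = (X - 1)^m v` with `v(1) = (m + 1) u(1) ≠ 0`, so
`h ≠ 0` and `ord₁ h = m` exactly, while `supp h ⊆ supp g \ {e}` (the operator multiplies the `n`-th
coefficient by `n - e`).  The induction hypothesis for `h` and `(m + 1) mod p ≤ m mod p + 1` finish.
-/

namespace Summit.ValiantsHypothesis.ValiantsHypothesis.Theorems.SublinearShadowSketch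

open Polynomial Finset
open Summit.ValiantsHypothesis.ValiantsHypothesis.Theorems.FeketeNoSparseSplitCyclic (cpf_coeff_op)

-- `Summit.ValiantsHypothesis.ValiantsHypothesis.…` is the tree's mandated single-conjunct layout (Sub = Summit).
set_option linter.dupNamespace false

/-- Support drop of the Euler operator: `supp (X·g' - e·g) ⊆ supp g \ {e}` for every natural `e`
(the `n`-th coefficient is multiplied by `n - e`). [folklore] -/
theorem cfa_support_sub {K : Type} [CommRing K] (g : K[X]) (e : ℕ) :
    (X * derivative g - C (e : K) * g).support ⊆ g.support.erase e := by
  intro n hn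
  rw [mem_support_iff, cpf_coeff_op] at hn
  rw [Finset.mem_erase, mem_support_iff]
  refine ⟨?_, fun h0 => hn (by rw [h0, mul_zero])⟩
  rintro rfl
  exact hn (by rw [sub_self, zero_mul])

/-- The Euler operator with `e = deg g` strictly lowers the number of monomials of a non-zero `g`.
[folklore] -/
theorem cfa_card_lt {K : Type} [CommRing K] (g : K[X]) (hg : g ≠ 0) :
    (X * derivative g - C (g.natDegree : K) * g).support.card < g.support.card :=
  calc (X * derivative g - C (g.natDegree : K) * g).support.card
      ≤ (g.support.erase g.natDegree).card := Finset.card_le_card (cfa_support_sub g _)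
    _ < g.support.card := Finset.card_erase_lt_of_mem (natDegree_mem_support_of_nonzero hg)

/-- The Euler operator on `(X - 1)^(m+1) · u`: one factor `X - 1` is lost and the cofactor is
`(m+1)·X·u + (X - 1)·(X·u' - e·u)`. [folklore] -/
theorem cfa_euler_factor {K : Type} [CommRing K] (u : K[X]) (m : ℕ) (e : K) :
    X * derivative ((X - C 1) ^ (m + 1) * u) - C e * ((X - C 1) ^ (m + 1) * u) =
      (X - C 1) ^ m * (C (m + 1 : K) * X * u + (X - C 1) * (X * derivative u - C e * u)) := by
  rw [derivative_mul, derivative_pow_succ, derivative_X_sub_C]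
  ring

/-- One step of the induction: if `(ord₁ g : K) ≠ 0` then the Euler transform `X·g' - e·g` is
non-zero and its order at `1` is exactly `ord₁ g - 1`. [folklore] -/
theorem cfa_step {K : Type} [Field K] (g : K[X]) (hg : g ≠ 0)
    (hμ : ((g.rootMultiplicity 1 : ℕ) : K) ≠ 0) (e : K) :
    X * derivative g - C e * g ≠ 0 ∧
      (X * derivative g - C e * g).rootMultiplicity 1 + 1 = g.rootMultiplicity 1 := by
  have hμ0 : g.rootMultiplicity 1 ≠ 0 := fun h0 => hμ (by rw [h0, Nat.cast_zero])
  obtain ⟨m, hm⟩ := Nat.exists_eq_add_one_of_ne_zero hμ0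
  obtain ⟨u, hgu, hndvd⟩ := g.exists_eq_pow_rootMultiplicity_mul_and_not_dvd hg 1
  rw [hm] at hgu hμ
  have hu1 : u.eval 1 ≠ 0 := by rwa [dvd_iff_isRoot] at hndvd
  have hfac : X * derivative g - C e * g =
      (X - C 1) ^ m * (C (m + 1 : K) * X * u + (X - C 1) * (X * derivative u - C e * u)) := by
    rw [hgu]
    exact cfa_euler_factor u m e
  have hv1 : (C (m + 1 : K) * X * u + (X - C 1) * (X * derivative u - C e * u)).eval 1 ≠ 0 := by
    simp only [eval_add, eval_mul, eval_sub, eval_C, eval_X, sub_self, zero_mul, add_zero, mul_one]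
    refine mul_ne_zero ?_ hu1
    exact_mod_cast hμ
  have hv0 : C (m + 1 : K) * X * u + (X - C 1) * (X * derivative u - C e * u) ≠ 0 :=
    fun h0 => hv1 (by rw [h0, eval_zero])
  refine ⟨?_, ?_⟩
  · rw [hfac]
    exact mul_ne_zero (pow_ne_zero _ (X_sub_C_ne_zero 1)) hv0
  · rw [hfac, hm, mul_comm ((X - C (1 : K)) ^ m), rootMultiplicity_mul_X_sub_C_pow hv0,
      rootMultiplicity_eq_zero hv1, zero_add]

/-- Elementary residue arithmetic: `(m + 1) mod p ≤ m mod p + 1`. [folklore] -/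
theorem cfa_succ_mod_le (m p : ℕ) : (m + 1) % p ≤ m % p + 1 := by
  rw [Nat.add_mod]
  exact (Nat.mod_le _ _).trans (Nat.add_le_add_left (Nat.mod_le _ _) _)

/-- **Stub (N1): the characteristic-`p` fewnomial lever at arbitrary degree.**  Over a field of
characteristic `p`, a non-zero polynomial `g` of any degree satisfies
`ord_{X=1}(g) mod p + 1 ≤ |supp g|`. [folklore] -/
theorem stub_charPFewnomialAnyDegree (K : Type) [Field K] (p : ℕ) [Fact p.Prime] [CharP K p]
    (g : Polynomial K) (hg : g ≠ 0) :
    g.rootMultiplicity 1 % p + 1 ≤ g.support.card := by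
  obtain ⟨n, hn⟩ : ∃ n, g.support.card ≤ n := ⟨_, le_rfl⟩
  induction n generalizing g with
  | zero =>
    exact absurd (Finset.card_pos.2 (support_nonempty.2 hg)) (by omega)
  | succ n ih =>
    by_cases hdvd : p ∣ g.rootMultiplicity 1
    · rw [Nat.mod_eq_zero_of_dvd hdvd]
      have := Finset.card_pos.2 (support_nonempty.2 hg)
      omega
    · have hμ : ((g.rootMultiplicity 1 : ℕ) : K) ≠ 0 :=
        fun h0 => hdvd ((CharP.cast_eq_zero_iff K p _).1 h0)
      obtain ⟨hh0, hord⟩ := cfa_step g hg hμ (g.natDegree : K)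
      have hlt := cfa_card_lt g hg
      have ih' := ih _ hh0 (by omega)
      have hmod := cfa_succ_mod_le
        ((X * derivative g - C (g.natDegree : K) * g).rootMultiplicity 1) p
      rw [hord] at hmod
      omega

end Summit.ValiantsHypothesis.ValiantsHypothesis.Theorems.SublinearShadowSketch
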